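import Summits.NavierStokesRegularity.NavierStokesRegularity.Theses.RellichScar
import Summits.NavierStokesRegularity.NavierStokesRegularity.Theorems.SymmetricScarExists.Negative.SpiralWorld
import Summits.NavierStokesRegularity.NavierStokesRegularity.Theorems.RellichScarSymmetricScarExistsDssNearOne
import Summits.NavierStokesRegularity.NavierStokesRegularity.Theorems.SqueezeCycleRecurrentLiouvilleNearIdentityRDSS

/-!
# Crux `SymmetricScarExists` (stmt-NavierStokesRegularity-11718), line `rdss-screw-split`: the SLOW-SCREW
# near-identity corner of child C (`RdssApexFatal`)

Helper file of the line lead (`--supports stmt-NavierStokesRegularity-11718`; theorems only, no definitions, no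
named-fact hypotheses).  Child C of the screw split (`Theorems/RellichScarSymmetricScarExistsSplit.lean`) — no
singular apex Type-I profile is a.e. fixed on the slab by a screw-dilation `u ↦ R_θ D_c u ∘ R_{−θ}`, `c > 1` —
is the field's open Type-I RDSS Liouville wall (Bradshaw–Tsai 2017 OP 5.1; canonical bridge
`RdssSplit.WallBridge.rdssApexFatal_of_typeIDSSLiouvilleConjecture`).  Next to the two landed unconditional
corners `dssApexFatal_nearOne` (`θ = 0`, `c` near `1`; Chae–Wolf 2017 Thm 1.3) and
`rssApexFatal_smallOrLargePitch` (Pineau–Vicol 2026 Thm 1.4) this file lands a third one: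

* `rdssApexFatal_slowScrew_nearOne` (registered auxiliary stub): for every rate constant `C` and every
  bound `M < ⊤` on `𝐈` there are `Λ > 1` and `α_ > 0` such that child C holds for all screws `(c, θ)` in the
  slow near-identity cone `1 < c < Λ`, `|θ| ≤ α_ log c` (Pineau–Vicol 2026 Thm 1.7(i)-type / Chae–Wolf 2017
  Thm 1.3 in the Albritton–Barker class).  It is the apex-class reading of the tree's LANDED
  `Theorems.stub_rlNearIdentityRDSSSlow` (crux RecurrentLiouville, stmt-NavierStokesRegularity-1589): a
  nonpositive constant kills the profile outright (`eq_zero_of_hasTypeIDecay_nonpos`); otherwise the apex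
  bound gives the Type-I rate (`HasTypeIDecay.hasTypeITimeDecay`), and the screw identity
  `R_θ D_c u ∘ R_{−θ} = u` a.e. is conjugated by `R_{−θ}` (`conjZ_ae_eq_slab`, `conjZ_conjZ`, `conjZ_zero`)
  into `D_c u = R_{−θ} u ∘ R_θ` a.e., the hypothesis of `stub_rlNearIdentityRDSSSlow` at `(c, −θ)`.

References: B. Pineau, V. Vicol, arXiv:2607.09619 (2026), Thms 1.6–1.7, Conj. 1.1 [PineauVicol2026];
D. Chae, J. Wolf, arXiv:1610.09464, Thm 1.3 [ChaeWolf2017RemovingDSS]; Z. Bradshaw, T.-P. Tsai, Comm. PDE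
42 (2017) = arXiv:1610.05680, §5 OP 5.1 [BradshawTsai2017CPDE]; D. Albritton, T. Barker, arXiv:1811.00502,
§2 [AlbrittonBarker2019].
-/

noncomputable section

open MeasureTheory Set Function Filter Topology TopologicalSpace Metric
open scoped NNReal ENNReal

namespace Summit.NavierStokesRegularity.NavierStokesRegularity.Theorems.SymmetricScarExists.RdssSplit.WallBridge

open Literature.Analysis.FluidPDE
open Summit.NavierStokesRegularity.NavierStokesRegularity.Theses.RellichScar
open Summit.NavierStokesRegularity.NavierStokesRegularity.Theorems.SymmetricScarExists.Negative
open Summit.NavierStokesRegularity.NavierStokesRegularity.Theorems.SymmetricScarExists.ScarWindow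
open Summit.NavierStokesRegularity.NavierStokesRegularity.Theorems (stub_rlNearIdentityRDSSSlow)

set_option linter.dupNamespace false

/-- **The screw identity conjugated by `R_{−θ}`**: if `R_θ D_c u ∘ R_{−θ} = u` a.e. on the slab, then
`D_c u = R_{−θ} u ∘ R_θ` a.e. on the slab (apply the measure-preserving conjugation `conjZ (−θ)` to both sides;
`conjZ (−θ) ∘ conjZ θ = id`). [folklore] -/
theorem nsRescale_ae_eq_conjZ_neg_of_screw {u : ℝ → EuclideanSpace ℝ (Fin 3) → EuclideanSpace ℝ (Fin 3)} {c θ : ℝ}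
    (h : uncurry (fun t x => rotZ θ (nsRescale c u t (rotZ (-θ) x)))
      =ᵐ[volume.restrict (Iio (0 : ℝ) ×ˢ (univ : Set (EuclideanSpace ℝ (Fin 3))))] uncurry u) :
    ∀ᵐ z ∂(volume.restrict (Iio (0 : ℝ) ×ˢ (univ : Set (EuclideanSpace ℝ (Fin 3))))),
      nsRescale c u z.1 z.2 = rotZ (-θ) (u z.1 (rotZ (-(-θ)) z.2)) := by
  have h' : uncurry (conjZ θ (nsRescale c u))
      =ᵐ[volume.restrict (Iio (0 : ℝ) ×ˢ (univ : Set (EuclideanSpace ℝ (Fin 3))))] uncurry u := h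
  have h2 := conjZ_ae_eq_slab (-θ) h'
  rw [conjZ_conjZ, neg_add_cancel, conjZ_zero] at h2
  filter_upwards [h2] with z hz
  exact hz

/-- **No slowly precessing near-identity screw-invariant singular apex profile** (registered auxiliary stub
`rdssApexFatal_slowScrew_nearOne` of crux stmt-NavierStokesRegularity-11718, line rdss-screw-split; the
slow-screw near-identity corner of child C, Pineau–Vicol 2026 Thm 1.7(i)-type / Chae–Wolf 2017 Thm 1.3 in the
apex class, via the tree's `stub_rlNearIdentityRDSSSlow`).  For every `C` and every `M < ⊤` there are `Λ > 1`,
`α_ > 0` such that for `1 < c < Λ` and `|θ| ≤ α_ log c` no suitable weak solution on the slab with a weak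
gradient, `𝐈 ≤ M` and the apex bound `‖u‖ ≤ C/(‖x‖ + √(−t))`, singular at the origin, satisfies
`R_θ (c u(c²t, c R_{−θ} x)) = u(t, x)` a.e. on the slab. [cite: PineauVicol2026, Theorem 1.7 (arXiv:2607.09619 p. 5)] -/
theorem rdssApexFatal_slowScrew_nearOne :
    ∀ (C : ℝ) (M : ℝ≥0∞), M < ⊤ → ∃ Λ αlow : ℝ, 1 < Λ ∧ 0 < αlow ∧ ∀ (c θ : ℝ), 1 < c → c < Λ → |θ| ≤ αlow * Real.log c → ∀ (u : ℝ → EuclideanSpace ℝ (Fin 3) → EuclideanSpace ℝ (Fin 3)) (p : ℝ → EuclideanSpace ℝ (Fin 3) → ℝ) (G : ℝ → EuclideanSpace ℝ (Fin 3) → EuclideanSpace ℝ (Fin 3) →L[ℝ] EuclideanSpace ℝ (Fin 3)), IsSuitableWeakSolutionOn (slab (EuclideanSpace ℝ (Fin 3)) (Iio 0) isOpen_Iio) 1 0 u p → HasWeakSpatialGradientOn (slab (EuclideanSpace ℝ (Fin 3)) (Iio 0) isOpen_Iio) u G → typeIBound (Iio (0 : ℝ) ×ˢ univ) u p G ≤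 M → HasTypeIDecay C u → IsBackwardSingularPoint u 0 → uncurry (fun t x => rotZ θ (nsRescale c u t (rotZ (-θ) x))) =ᵐ[volume.restrict (Iio (0 : ℝ) ×ˢ univ)] uncurry u → False := by
  intro C M hM
  obtain ⟨Λ, αlow, hΛ, hα, H⟩ := stub_rlNearIdentityRDSSSlow C M hM
  refine ⟨Λ, αlow, hΛ, hα, fun c θ h1 h2 hθ u p G hsw hwg hI hdec hsing hrdss => ?_⟩
  rcases le_or_gt C 0 with hC0 | hC
  · -- a nonpositive constant: the field vanishes on the slab
    refine not_isBackwardSingularPoint_of_ae_zero_slab (u := u) ?_ hsing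
    filter_upwards [ae_restrict_mem (measurableSet_Iio.prod MeasurableSet.univ)] with w hw
    exact eq_zero_of_hasTypeIDecay_nonpos hC0 hdec hw.1 w.2
  · have hθ' : |(-θ)| ≤ αlow * Real.log c := by rwa [abs_neg]
    exact H c (-θ) h1 h2 hθ' u p G hsw hwg hI (hdec.hasTypeITimeDecay hC.le)
      (nsRescale_ae_eq_conjZ_neg_of_screw hrdss) hsing

end Summit.NavierStokesRegularity.NavierStokesRegularity.Theorems.SymmetricScarExists.RdssSplit.WallBridge

end
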